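import Summits.AtomisticToContinuum.Crystallization.Theorems.ExcessDecayLiouvilleScaleStep
import Summits.AtomisticToContinuum.Crystallization.Theorems.ExcessDecayLiouvilleTotalGradientGen
import Summits.AtomisticToContinuum.Crystallization.Theorems.ExcessDecayLiouvilleChainInvDefs
import Summits.AtomisticToContinuum.Crystallization.Theorems.ExcessDecayLiouvilleScaleArithJump
import Summits.AtomisticToContinuum.Crystallization.Theorems.ExcessDecayLiouvilleNextConstantProp

/-!
# Route `ExcessDecayLiouville`: one scale of the chain from the invariant (nonlinear half, XXXIX)

Harmonic-replacement architecture for item `ExcessDecay` (stmt-AtomisticToContinuum-9334), nonlinear half.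
From the chain invariant `ChainInv` at `(σ, γ)` and the (scale-independent) chain hypotheses, `inv_facts` extracts the
numerical facts of the current step (thresholds, `Du`-consumption, Lipschitz modulus, slope scale from the potential),
and `inv_scale_step` feeds them to `scale_step`: the output is the next relaxed approximant with its data, the
correction `w`, and the pointwise envelope on `B_{σ²}(c₀)`, with all currencies NAMED at
`(κ, σ², γ², r, δ, Du, Du, ‖a 0 − a 1‖, ‖B‖, ν²r⁷)`.
All `[folklore]`; helper lemmas, nothing here closes an item.
-/

noncomputable section

namespace Summit.AtomisticToContinuum.Crystallization.Theorems.ExcessDecayLiouville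

open scoped BigOperators Topology InnerProductSpace RealInnerProductSpace Classical
open Literature.MathematicalPhysics.StatisticalMechanics
open Summit.AtomisticToContinuum.Crystallization.Theorems.PhononStabilityNegative

local notation "E3" => EuclideanSpace ℝ (Fin 3)

-- Local notation: the force-constant map `K(e)w = h(|e|²)w + 2⟪e,w⟫h′(|e|²)e`.
local notation3 "𝕂[" e "] " w:max =>
  (-((‖e‖ ^ 2)⁻¹) ^ 7 + ((‖e‖ ^ 2)⁻¹) ^ 4) • w + (2 * ⟪e, w⟫ * (7 * ((‖e‖ ^ 2)⁻¹) ^ 8 - 4 * ((‖e‖ ^ 2)⁻¹) ^ 5)) • e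
-- Local notation: the pair force `F(x) = h(|x|²) x`.
local notation3 "𝐅[" x "]" => ((-((‖x‖ ^ 2)⁻¹) ^ 7 + ((‖x‖ ^ 2)⁻¹) ^ 4) • x)
set_option quotPrecheck false in
-- Local notation: ball indicator.
local notation "𝟙ᵇ[" x ", " c ", " R "]" => (if dist (x : EuclideanSpace ℝ (Fin 3)) c ≤ R then (1 : ℝ) else 0)

section

variable {X : Set E3} {c : E3} {r ε δ κ : ℝ} {t : Fin 2 → E3} {A : E3 →L[ℝ] E3} {π : E3 → E3}
  {aff₀ aff : E3 → E3} {a : Fin 2 → E3} {B : E3 →L[ℝ] E3} {c₀ : E3}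

variable (hA : Adm₀ A) (hI : Inner₀ t A)

set_option quotPrecheck false in
-- Local notation: the operator row `(L v)(p)`.
local notation "𝕃" v:max " @ " p:max =>
  tsum (fun q : Sites₀ t A => (if ((p : Sites₀ t A) : E3) ≠ q then 𝕂[((p : Sites₀ t A) : E3) - q] (v ((p : Sites₀ t A) : E3) - v q) else 0))
set_option quotPrecheck false in
-- Local notation: the finite near-neighbour form on the ball of radius `X` about `c₀`.
local notation "NN[" v ", " X "]" =>
  (∑ p ∈ (finite_sites_dist_le (t := t) (A := A) hA hI c₀ X).toFinset,
    ∑ q ∈ (finite_sites_dist_le (t := t) (A := A) hA hI c₀ X).toFinset,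
      (if p ≠ q ∧ dist p q ≤ 11 / 10 then ‖v p - v q‖ ^ 2 else (0 : ℝ)))
set_option quotPrecheck false in
-- local mass on the ball of radius `X` about `c₀`
local notation "𝐌[" f ", " X "]" =>
  tsum (fun p : Sites₀ t A => ‖f (p : E3)‖ ^ 2 * 𝟙ᵇ[p, c₀, X])
set_option quotPrecheck false in
-- Local notation: the displaced self-force `G(p)` of the background `aff`.
local notation "𝐆[" aff "] " p:max =>
  tsum (fun q : Sites₀ t A => (if (p : E3) ≠ q then 𝐅[((p : E3) - q) + (aff (p : E3) - aff q)] else 0))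
set_option quotPrecheck false in
-- Local notation: the radial site cut-off `= 1` on the sites of `B_{r₁}(c)`, `0` beyond `r₁ + w`, slope `1/w`.
local notation "𝛘[" r₁ ", " w "]" =>
  (fun x : EuclideanSpace ℝ (Fin 3) => (if x ∈ Sites₀ t A then max (min 1 ((r₁ + w - dist x c) / w)) 0 else 0))

/-- Monotonicity of the Lipschitz modulus in the jump and the slope. [folklore] -/
theorem lamOf_mono {Du j j' b b' : ℝ} (hj : j ≤ j') (hb : b ≤ b') : lamOf Du j b ≤ lamOf Du j' b' := by
  unfold lamOf; nlinarith

include hA hI in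
/-- The radial site cut-off of `B_r(c)` of width `r/4`: the seven properties consumed by `scale_step`. [folklore] -/
theorem chainCutoff_props (hr : 0 < r) (SR : Finset E3) (hSR : ∀ x, x ∈ SR ↔ x ∈ Sites₀ t A ∧ dist x c ≤ r) :
    (∀ q ∈ Sites₀ t A, q ∉ SR → 𝛘[r / 2, r / 4] q = 0) ∧ (∀ x, x ∉ Sites₀ t A → 𝛘[r / 2, r / 4] x = 0) ∧
    (∀ x, |𝛘[r / 2, r / 4] x| ≤ 1) ∧ (∀ x, |1 - 𝛘[r / 2, r / 4] x| ≤ 1) ∧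
    (∀ q ∈ SR, dist q c ≤ r / 2 → 𝛘[r / 2, r / 4] q = 1) ∧
    (∀ x ∈ Sites₀ t A, 3 * r / 4 < dist x c → 𝛘[r / 2, r / 4] x = 0) ∧
    (Function.support 𝛘[r / 2, r / 4]).Finite := by
  have hw : 0 < r / 4 := by positivity
  refine ⟨?_, fun x hx => siteCutoff_eq_zero_of_not_mem hx, ?_, ?_, ?_, ?_, siteCutoff_support_finite hA hI c (r / 2) hw⟩
  · intro q hq hqSR
    have hqc : r < dist q c := lt_of_not_ge fun h => hqSR ((hSR q).2 ⟨hq, h⟩)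
    exact siteCutoff_eq_zero_of_le hw (by linarith)
  · intro x
    rw [abs_of_nonneg (siteCutoff_nonneg c _ _ x)]; exact siteCutoff_le_one c _ _ x
  · intro x
    have h0 := siteCutoff_nonneg (t := t) (A := A) c (r / 2) (r / 4) x
    have h1 := siteCutoff_le_one (t := t) (A := A) c (r / 2) (r / 4) x
    rw [abs_le]; constructor <;> linarith
  · exact fun q hq hqc => siteCutoff_eq_one hw ((hSR q).1 hq).1 hqc
  · exact fun x _ hxd => siteCutoff_eq_zero_of_le hw (by linarith)

/-- **The numerical facts of the current step from the invariant.** [folklore] -/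
theorem inv_facts (hκ0 : 0 < κ) (hκ1 : κ ≤ 1) (hr : 192 ≤ r)
    (SR : Finset E3) (hSR : ∀ x, x ∈ SR ↔ x ∈ Sites₀ t A ∧ dist x c ≤ r) (hc₀ : dist c₀ c ≤ r / 8)
    {Du ν σ₀ γ₀ Ustar Vstar b₀ j₀ Du₀ : ℝ} (hDu0 : 0 ≤ Du) (hν : 0 ≤ ν) (hγ₀ : 0 ≤ γ₀) (hδ : 0 < δ)
    (hσ₀r : 737600 * σ₀ ^ 2 + 153600 ≤ r)
    (hDu₀ : ∀ x ∈ SR, ‖(π x - x) - aff₀ x‖ ≤ Du₀)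
    (C3 : Du₀ + lcOf κ ^ 8 * Vstar +
      (lcOf κ ^ 13 + 14 * lcOf κ ^ 8 + 12 * lcOf κ ^ 8 * (5 * r / 4 + 11 / 10)) * (Ustar + Du / r ^ 2) ≤ Du)
    {σ γ U Vb : ℝ}
    (hinv : ChainInv t A π c r c₀ aff₀ (lcOf κ) (phiOf Du r δ) ν Du Ustar Vstar b₀ j₀ σ₀ γ₀ σ γ U Vb aff a B) :
    8 ≤ σ ∧ 64 ≤ σ ^ 2 ∧ σ ^ 2 ≤ r ∧ 737600 * σ ^ 2 + 153600 ≤ r ∧ 0 ≤ γ ∧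
    U ≤ Ustar + Du / r ^ 2 ∧ Vb ≤ Vstar ∧
    ‖B‖ ≤ b₀ + 12 * lcOf κ ^ 8 * (Ustar + Du / r ^ 2) ∧
    ‖a 0 - a 1‖ ≤ j₀ + 2 * lcOf κ ^ 13 * (Ustar + Du / r ^ 2) ∧
    (∀ x ∈ SR, ‖(π x - x) - aff x‖ ≤ Du) ∧
    sAgg σ γ (phiOf Du r δ) Du r ν ≤ Ustar / 2 + Du / (4 * r ^ 2) := by
  obtain ⟨-, -, -, hBle, hale, hdisp, hU0, hVb0, hpotU, hpotV, hσm, hσσ₀, hγ₀γ⟩ := hinv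
  obtain ⟨hL, -, -⟩ := lcOf_ge hκ0 hκ1
  set L := lcOf κ with hLdef
  have hL0 : 0 ≤ L := le_trans (by norm_num) hL
  have hL1 : 1 ≤ L := le_trans (by norm_num) hL
  have hr0 : 0 < r := by linarith
  have hΦ0 : 0 ≤ phiOf Du r δ := by unfold phiOf; positivity
  have hσ8 : 8 ≤ σ := le_trans (le_trans (by norm_num) (le_trans hL (le_self_pow₀ hL1 (by norm_num)))) hσm
  have hσ0 : 0 < σ := by linarith
  have hσ64 : 64 ≤ σ ^ 2 := by
    calc (64 : ℝ) = 8 * 8 := by norm_num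
      _ ≤ σ * σ := mul_le_mul hσ8 hσ8 (by norm_num) hσ0.le
      _ = σ ^ 2 := by ring
  have hσσ₀2 : σ ^ 2 ≤ σ₀ ^ 2 := pow_le_pow_left₀ hσ0.le hσσ₀ 2
  have hρr : 737600 * σ ^ 2 + 153600 ≤ r := by linarith
  have hσr : σ ^ 2 ≤ r := by linarith [sq_nonneg σ]
  have hγ : 0 ≤ γ := hγ₀.trans hγ₀γ
  -- U ≤ U⋆ + Du/r²
  have hDσ : 0 ≤ Du / (σ * r ^ 2) := by positivity
  have hϑσ : 2 * (1 / (4 * L ^ 10)) * (Du / (σ * r ^ 2)) ≤ Du / r ^ 2 := by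
    have h1 : 2 * (1 / (4 * L ^ 10)) ≤ 1 := by
      rw [show 2 * (1 / (4 * L ^ 10)) = 1 / (2 * L ^ 10) by ring, div_le_one (by positivity)]
      linarith [one_le_pow₀ (M₀ := ℝ) (n := 10) hL1]
    have h2 : Du / (σ * r ^ 2) ≤ Du / r ^ 2 :=
      div_le_div_of_nonneg_left hDu0 (by positivity) (le_mul_of_one_le_left (by positivity) (by linarith))
    calc 2 * (1 / (4 * L ^ 10)) * (Du / (σ * r ^ 2)) ≤ 1 * (Du / (σ * r ^ 2)) := mul_le_mul_of_nonneg_right h1 hDσ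
      _ ≤ Du / r ^ 2 := by rw [one_mul]; exact h2
  have hUmax : U ≤ Ustar + Du / r ^ 2 := by
    have h1 : 0 ≤ γ * σ := by positivity
    have h2 : 0 ≤ σ ^ 2 * (phiOf Du r δ + ν) := by positivity
    linarith
  have hVmax : Vb ≤ Vstar := by
    have : 0 ≤ vAgg σ γ (phiOf Du r δ) Du r := by unfold vAgg; positivity
    linarith
  have hUm0 : 0 ≤ Ustar + Du / r ^ 2 := hU0.trans hUmax
  have hB' : ‖B‖ ≤ b₀ + 12 * L ^ 8 * (Ustar + Du / r ^ 2) := by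
    have := mul_le_mul_of_nonneg_left hUmax (by positivity : (0 : ℝ) ≤ 12 * L ^ 8); linarith
  have ha' : ‖a 0 - a 1‖ ≤ j₀ + 2 * L ^ 13 * (Ustar + Du / r ^ 2) := by
    have := mul_le_mul_of_nonneg_left hUmax (by positivity : (0 : ℝ) ≤ 2 * L ^ 13); linarith
  -- Du-consumption
  have hDu : ∀ x ∈ SR, ‖(π x - x) - aff x‖ ≤ Du := by
    intro x hx
    obtain ⟨hxS, hxc⟩ := (hSR x).1 hx
    have hd : dist x c₀ ≤ 9 * r / 8 := by
      have := dist_triangle x c c₀; rw [dist_comm c c₀] at this; linarith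
    have h1 := hdisp x hxS
    have h2 := hDu₀ x hx
    have e : (π x - x) - aff x = ((π x - x) - aff₀ x) - (aff x - aff₀ x) := by abel
    rw [e]
    refine (norm_sub_le _ _).trans ?_
    have hcoef : (L ^ 13 + 14 * L ^ 8 + 12 * L ^ 8 * (dist x c₀ + 11 / 10)) * U ≤
        (L ^ 13 + 14 * L ^ 8 + 12 * L ^ 8 * (5 * r / 4 + 11 / 10)) * (Ustar + Du / r ^ 2) := by
      refine mul_le_mul ?_ hUmax hU0 (by positivity)
      have : dist x c₀ ≤ 5 * r / 4 := by linarith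
      have h8 := mul_le_mul_of_nonneg_left this (by positivity : (0 : ℝ) ≤ 12 * L ^ 8)
      linarith
    have hV' : L ^ 8 * Vb ≤ L ^ 8 * Vstar := mul_le_mul_of_nonneg_left hVmax (by positivity)
    linarith only [h1, h2, hcoef, hV', C3]
  -- the slope scale from the potential
  have hS := sAgg_le_of_pot (γ := γ) (Φ := phiOf Du r δ) (ν := ν) hL hσ8 hDu0 hr0 hU0 hpotU
  refine ⟨hσ8, hσ64, hσr, hρr, hγ, hUmax, hVmax, hB', ha', hDu, ?_⟩
  unfold sAgg; exact hS

-- the statement of `scale_step` in the twenty named currencies; ~3·10⁵ heartbeats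
set_option maxHeartbeats 400000 in
include hA hI in
/-- **One scale of the chain from the invariant**: `scale_step` at `(ρ, C) = (σ², γ²)` with `Dv = Du`,
`N_tot = ν²r⁷` and the radial site cut-off, all its numerical hypotheses discharged from `ChainInv` and the chain
hypotheses. [folklore] -/
theorem inv_scale_step (hκ0 : 0 < κ) (hκ1 : κ ≤ 1)
    (hκ : ∀ v : E3 → E3, (Function.support v).Finite →
      Function.support v ⊆ Sites₀ t A → κ * nnForm t A v ≤ ∑' p : Sites₀ t A, ⟪𝕃 v @ p, v p⟫)
    (hX : X.Finite) (hsep : Sep₀ X δ) (hequil : Equil₀ X) (hδ : 0 < δ) (hδ1 : δ ≤ 1)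
    (hε0 : 0 ≤ ε) (hε : 2 * ε < δ) (hr : 192 ≤ r)
    (hXb : ∀ p ∈ X, dist p c ≤ r → ∃ m : Fin 2, ∃ z ∈ Λ₀, dist p (t m + A z) ≤ ε)
    (hπ : ∀ s' ∈ Sites₀ t A, dist s' c ≤ r → π s' ∈ X ∧ dist (π s') s' ≤ ε)
    (hinj : ∀ s₁ ∈ Sites₀ t A, ∀ s₂ ∈ Sites₀ t A, dist s₁ c ≤ r → dist s₂ c ≤ r → π s₁ = π s₂ → s₁ = s₂)
    (SR : Finset E3) (hSR : ∀ x, x ∈ SR ↔ x ∈ Sites₀ t A ∧ dist x c ≤ r) (hc₀ : dist c₀ c ≤ r / 8)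
    -- chain constants
    {Du ν σ₀ γ₀ Ustar Vstar b₀ j₀ Du₀ : ℝ} (hDu0 : 0 ≤ Du) (hDu1 : Du ≤ 1 / 20) (hν : 0 ≤ ν) (hγ₀ : 0 ≤ γ₀)
    {ja jb : ℝ} (hN : ntotGen κ r δ ε Du ja jb ≤ ν ^ 2 * r ^ 7)
    (Cja : j₀ + 2 * lcOf κ ^ 13 * (Ustar + Du / r ^ 2) ≤ ja) (hja : ja ≤ 1 / 100)
    (Cjb : b₀ + 12 * lcOf κ ^ 8 * (Ustar + Du / r ^ 2) ≤ jb)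
    (CΛ : 4000000 * (210000 * ((25 / 23) * (2 * Du + ja) + jb)) ≤ κ / 12)
    (hσ₀r : 737600 * σ₀ ^ 2 + 153600 ≤ r)
    (hDu₀ : ∀ x ∈ SR, ‖(π x - x) - aff₀ x‖ ≤ Du₀)
    (C1 : lcOf κ ^ 13 * (Ustar / 2 + Du / (4 * r ^ 2)) ≤ κ ^ 2 / 10 ^ 11)
    (C2a : j₀ + 2 * lcOf κ ^ 13 * (Ustar + Du / r ^ 2) ≤ κ / (2 * 10 ^ 10))
    (C2b : b₀ + 12 * lcOf κ ^ 8 * (Ustar + Du / r ^ 2) ≤ κ / (2 * 10 ^ 10))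
    (C2c : 2 * r * (b₀ + 12 * lcOf κ ^ 8 * (Ustar + Du / r ^ 2)) ≤ 1 / 100)
    (C3 : Du₀ + lcOf κ ^ 8 * Vstar +
      (lcOf κ ^ 13 + 14 * lcOf κ ^ 8 + 12 * lcOf κ ^ 8 * (5 * r / 4 + 11 / 10)) * (Ustar + Du / r ^ 2) ≤ Du)
    (C4a : 4000000 * lamOf Du (j₀ + 2 * lcOf κ ^ 13 * (Ustar + Du / r ^ 2)) (b₀ + 12 * lcOf κ ^ 8 * (Ustar + Du / r ^ 2)) ≤ κ / 16)
    {σ γ U Vb : ℝ}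
    (hinv : ChainInv t A π c r c₀ aff₀ (lcOf κ) (phiOf Du r δ) ν Du Ustar Vstar b₀ j₀ σ₀ γ₀ σ γ U Vb aff a B) :
    ∃ (z₀ : E3) (aT : Fin 2 → E3) (BT : E3 →L[ℝ] E3) (ξ : E3) (w : E3 → E3),
      z₀ ∈ Λ₀ ∧ dist (t 0 + A z₀) c₀ ≤ 11 / 10 ∧
      ‖BT‖ ≤ 12 * Real.sqrt (thetaOneOf κ (σ ^ 2) (γ ^ 2) r δ Du Du ‖a 0 - a 1‖ ‖B‖ (ν ^ 2 * r ^ 7)) ∧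
      ‖aT 0 - aT 1‖ ≤ κ / (2 * 10 ^ 10) ∧
      ‖aT 0 - aT 1‖ ≤ jumpOf κ (σ ^ 2) (thetaOneOf κ (σ ^ 2) (γ ^ 2) r δ Du Du ‖a 0 - a 1‖ ‖B‖ (ν ^ 2 * r ^ 7)) (thetaTwoOf κ (σ ^ 2) (γ ^ 2) r δ Du Du ‖a 0 - a 1‖ ‖B‖ (ν ^ 2 * r ^ 7))
        (Real.sqrt (vsqOf κ (σ ^ 2) (γ ^ 2) r δ Du Du ‖a 0 - a 1‖ ‖B‖)) (jhOf κ (σ ^ 2) (γ ^ 2) r δ Du Du ‖a 0 - a 1‖ ‖B‖) ∧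
      (∀ m, ‖aT m‖ ≤ Real.sqrt (vsqOf κ (σ ^ 2) (γ ^ 2) r δ Du Du ‖a 0 - a 1‖ ‖B‖) + 11 / 10 * ‖BT‖) ∧
      ‖ξ‖ ≤ xiOf κ (σ ^ 2) (thetaOneOf κ (σ ^ 2) (γ ^ 2) r δ Du Du ‖a 0 - a 1‖ ‖B‖ (ν ^ 2 * r ^ 7)) (thetaTwoOf κ (σ ^ 2) (γ ^ 2) r δ Du Du ‖a 0 - a 1‖ ‖B‖ (ν ^ 2 * r ^ 7))
        (Real.sqrt (vsqOf κ (σ ^ 2) (γ ^ 2) r δ Du Du ‖a 0 - a 1‖ ‖B‖)) (jhOf κ (σ ^ 2) (γ ^ 2) r δ Du Du ‖a 0 - a 1‖ ‖B‖) ∧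
      (∀ (m : Fin 2) (z : E3), z ∈ Λ₀ →
        (fun x : E3 => aff x + ((if (∃ z ∈ Λ₀, x = t 1 + A z) then aT 1 else aT 0) + BT (x - (t 0 + A z₀))) +
          (if (∃ z ∈ Λ₀, x = t 0 + A z) then ξ else 0)) (t m + A z) =
          (![a 0 + aT 0 + BT (c₀ - (t 0 + A z₀)) + ξ, a 1 + aT 1 + BT (c₀ - (t 0 + A z₀))] : Fin 2 → E3) m +
            (B + BT) (t m + A z - c₀)) ∧
      (∀ p : Sites₀ t A, 𝐆[fun x : E3 => aff x + ((if (∃ z ∈ Λ₀, x = t 1 + A z) then aT 1 else aT 0) + BT (x - (t 0 + A z₀))) +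
          (if (∃ z ∈ Λ₀, x = t 0 + A z) then ξ else 0)] p = 0) ∧
      (Function.support w).Finite ∧
      ∑' q : Sites₀ t A, ‖w q‖ ^ 2 ≤ wsqOf κ (σ ^ 2) (γ ^ 2) r δ Du Du ‖a 0 - a 1‖ ‖B‖ ∧
      (∀ x ∈ Sites₀ t A, dist x c₀ ≤ (σ ^ 2) →
        ‖𝛘[r / 2, r / 4] x • ((π x - x) - (aff x + ((if (∃ z ∈ Λ₀, x = t 1 + A z) then aT 1 else aT 0) + BT (x - (t 0 + A z₀))) +
          (if (∃ z ∈ Λ₀, x = t 0 + A z) then ξ else 0))) + w x‖ ^ 2 ≤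
          3 * (1428 * Real.sqrt (thetaTwoOf κ (σ ^ 2) (γ ^ 2) r δ Du Du ‖a 0 - a 1‖ ‖B‖ (ν ^ 2 * r ^ 7)) * (dist x c₀ + 11 / 10) ^ 2) ^ 2 + 3 * ‖ξ‖ ^ 2)  := by
  obtain ⟨hσ8, hσ64, hσr, hρr, hγ, hUmax, hVmax, hB', ha', hDu, hS⟩ :=
    inv_facts (aff₀ := aff₀) (aff := aff) (a := a) (B := B) hκ0 hκ1 hr SR hSR hc₀ hDu0 hν hγ₀ hδ hσ₀r hDu₀ C3 hinv
  obtain ⟨haff, hrelax, hmass, hBle, hale, hdisp, hU0, hVb0, hpotU, hpotV, hσm, hσσ₀, hγ₀γ⟩ := hinv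
  obtain ⟨hL, -, -⟩ := lcOf_ge hκ0 hκ1
  have hr0 : 0 < r := by linarith
  have hr1 : (1 : ℝ) ≤ r := by linarith
  obtain ⟨hχ0, hχS, hχabs, hχ1abs, hχone, hχfar, hχfin⟩ := chainCutoff_props hA hI hr0 SR hSR
  -- thresholds of the data
  have hj0 : 0 ≤ ‖a 0 - a 1‖ := norm_nonneg _
  have hb0 : 0 ≤ ‖B‖ := norm_nonneg _
  have ha'' : ‖a 0 - a 1‖ ≤ κ / (2 * 10 ^ 10) := ha'.trans C2a
  have hB'' : ‖B‖ ≤ κ / (2 * 10 ^ 10) := hB'.trans C2b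
  have hBr : 2 * r * ‖B‖ ≤ 1 / 100 := le_trans (mul_le_mul_of_nonneg_left hB' (by positivity)) C2c
  have hκs : κ / (2 * 10 ^ 10) ≤ 1 / 100 := by
    rw [div_le_div_iff₀ (by positivity) (by norm_num)]; linarith
  -- the Lipschitz modulus
  have hΛle := lamOf_mono (Du := Du) ha' hB'
  have hΛκ : 4000000 * lamOf Du ‖a 0 - a 1‖ ‖B‖ ≤ κ / 16 := le_trans (by linarith) C4a
  have hΛ1 : lamOf Du ‖a 0 - a 1‖ ‖B‖ ≤ 1 := by linarith
  -- the crude bound of the cut-off field and the global gradient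
  have hvD : ∀ x, ‖𝛘[r / 2, r / 4] x • ((π x - x) - aff x)‖ ≤ Du := by
    intro x
    rw [norm_smul, Real.norm_eq_abs]
    by_cases hxSR : x ∈ SR
    · calc _ ≤ 1 * Du := mul_le_mul (hχabs x) (hDu x hxSR) (norm_nonneg _) zero_le_one
        _ = Du := one_mul _
    · by_cases hxS : x ∈ Sites₀ t A
      · rw [hχ0 x hxS hxSR, abs_zero, zero_mul]; exact hDu0
      · rw [hχS x hxS, abs_zero, zero_mul]; exact hDu0
  have hNNtot : ∀ Xr, NN[(fun x => 𝛘[r / 2, r / 4] x • ((π x - x) - aff x)), Xr] ≤ ν ^ 2 * r ^ 7 := fun Xr =>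
    (NN_total_le_gen hA hI hκ0 hκ hX hsep hequil hδ hδ1 hε0 hε (by linarith) hXb hπ hinj SR hSR haff hrelax (ha'.trans Cja) hja
      (hB'.trans Cjb) hBr hDu0 hDu1 hDu CΛ c₀ Xr).trans hN
  -- the three thresholds of the step from the slope scale
  have hsmall : lcOf κ ^ 13 * (γ * σ + σ ^ 2 * phiOf Du r δ + Du / (σ * r ^ 2) + σ ^ 2 * ν) ≤ κ ^ 2 / 10 ^ 11 := by
    have hS' : γ * σ + σ ^ 2 * phiOf Du r δ + Du / (σ * r ^ 2) + σ ^ 2 * ν ≤ Ustar / 2 + Du / (4 * r ^ 2) := by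
      unfold sAgg at hS; exact hS
    exact le_trans (mul_le_mul_of_nonneg_left hS' (by positivity)) C1
  obtain ⟨hs₁, hs₂, hs₃⟩ := step_thresholds (δ := δ) hκ0 hκ1 hσ8 hσr hγ hr1 hδ hDu0 hj0 hb0 hΛ1 hν hsmall
  exact scale_step hA hI hκ0 hκ1 hκ hX hsep hequil hδ hδ1 hε0 hε hr hXb hπ hinj SR hSR (𝛘[r / 2, r / 4]) hχ0 hχS
    hχabs hχ1abs hχone hχfar hχfin haff hrelax ha'' hB'' hBr hc₀ hσ64 hρr (sq_nonneg γ) hDu0 hDu1 hDu hΛκ hvD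
    (by positivity) hNNtot hmass hs₁ hs₂ hs₃

end

end Summit.AtomisticToContinuum.Crystallization.Theorems.ExcessDecayLiouville

end
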